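import Mathlib.NumberTheory.Padics.PadicNumbers
import Mathlib.NumberTheory.Padics.RingHoms
import Mathlib.NumberTheory.Padics.Complex
import Mathlib.NumberTheory.Cyclotomic.Basic
import Mathlib.NumberTheory.GaussSum
import Mathlib.NumberTheory.DirichletCharacter.Basic
import Mathlib.RingTheory.PowerSeries.Basic
import Mathlib.RingTheory.RootsOfUnity.Basic
import Literature.NumberTheory.EllipticCurves.ModularSymbols
import Literature.NumberTheory.EllipticCurves.IwasawaAlgebra
import Literature.NumberTheory.EllipticCurves.ZpExtension
import Literature.NumberTheory.EllipticCurves.CuspFormLFunction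
import Literature.NumberTheory.EllipticCurves.AnalyticRank
import Literature.NumberTheory.EllipticCurves.GlobalMinimalModel
import Literature.NumberTheory.EllipticCurves.Tamagawa
import Literature.NumberTheory.EllipticCurves.GaloisAction
import HarnessLib

-- D-0014 sorry-sweep (operator, 2026-08-13): sorried theorems -> named facts `def X : Prop`; partial proofs preserved in comments
-- provenance: harness21/H21/H21/Prelude/EllArithM/PAdicLFunction.lean @ baafd6a (interim HEAD d8f2665); M5 mechanical rewrite
/-!
# The `p`-adic `L`-function of a modular elliptic curve (trunk EllArithM, item C19)

We formalise the Mazur–Swinnerton-Dyer / Mazur–Tate–Teitelbaum construction of the cyclotomic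
`p`-adic `L`-function of a weight-`2` cusp form `f ∈ S_2(Γ₀(N))` (in particular of a modular
elliptic curve `E / ℚ`) at a good *ordinary* prime `p`, from modular symbols, together with its
interpolation property.

* `IsOrdinaryAt W p`: `W` has good reduction at `p` and `p ∤ a_p` (item G06 names) — a
  definition (predicate, `[folklore]`), not a named fact (reclassified 2026-08-15: with its
  binders supplied by section `variable`s it read as a closed `def … : Prop` and was counted as
  literature debt; name, binder order and body are unchanged).
* `unitRoot W p : ℤ_[p]`: the unit root `α` of `X² - a_p X + p` (Hensel; junk `0`).
* `ratPlusSymbol f r : ℚ`: the rational number `[r]⁺_f = re (plusSymbol f r) / Ω⁺_f` (item C9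
  conventions: `plusSymbol = ({∞, r} + {∞, -r})/2`, `re Λ_f = ℤ Ω⁺/2` so `Ω⁺` includes the number
  of real components, `[0]⁺ = L(f, 1)/Ω⁺`); it exists for rational newforms (Manin–Drinfeld), and we
  must pass through `ℚ` since real numbers do not map to `ℚ_p` (junk `0`).
* `msdMeasure f α n a : ℚ_[p]`: `μ_{f,α}(a + pⁿℤ_p) = α⁻ⁿ [a/pⁿ]⁺ - α⁻ⁿ⁻¹ [a/pⁿ⁻¹]⁺` (MTT §I.10),
  and its distribution relation `msdMeasure_distribution`.
* `cyclotomicGenerator p = γ = 1 + p^{e₀}` (`e₀ = 1`, resp. `2` for `p = 2`), the topological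
  generator of `Γ = 1 + p^{e₀}ℤ_p = ℤ_p^× / torsion`; the power-series variable is `T = γ - 1`.
* `padicLRiemannSum`, `padicLCoeff f α k = ∫_{ℤ_p^×} (ℓ(x) choose k) dμ_{f,α}(x)` (limit of Riemann
  sums; `x = ω(x) γ^{ℓ(x)}`), `padicLFunction f α = L_p(f, α, T) = ∑_k padicLCoeff f α k T^k
  = ∫_{ℤ_p^×} (1 + T)^{ℓ(x)} dμ_{f,α}` and `padicLFunctionE W p _ = L_p(E, T)` with `α = unitRoot`.
* `IsPAdicLFunctionOf f p α L`: the interpolation package (MTT (14.3)):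
  `L(0) = (1 - α⁻¹)² [0]⁺` and, for `χ` a primitive character of conductor `p^m`, `m ≥ 1`, trivial
  on the torsion of `ℤ_p^×`, `L(χ(γ) - 1) = α⁻ᵐ ∑_a χ(a) [a/p^m]⁺` in `ℂ_p`; the right-hand side is
  `α⁻ᵐ τ(χ) L(f, χ̄, 1)/Ω⁺` by Birch's formula (`ratTwistedSymbolSum_mul_plusPeriod`).
* Named facts (`def … : Prop`, D-0014): `unitRoot_spec`, `msdMeasure_distribution`,
  `tendsto_padicLRiemannSum` (`μ_{f,α}` is a measure for a unit root),
  `isPAdicLFunctionOf_padicLFunction` (MSD 1974, MTT 1986), `padicLFunction_mem_integral`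
  (`L_p(E) ∈ Λ` under irreducibility of `E[p]`; Stevens, Greenberg–Vatsal),
  `padicLFunction_ne_zero` (Rohrlich).

## Design notes

* Everything is in `namespace Literature`; the modular-symbol material of item C9 lives in
  `Literature.ModularForms`, which we open.
* Mathlib has `ℚ_[p]`, `ℤ_[p]`, `PadicInt.toZModPow`, `ℂ_[p] = PadicComplex p` (a complete
  algebraically closed nontrivially normed field over `ℚ_[p]`, used as the common home of the
  values of `p`-power-conductor Dirichlet characters and of `L_p(χ(γ) - 1)`; this replaces the
  outline's `CyclotomicField (p^n) ℚ_[p]`, which carries no norm, so that `L(ζ - 1)` could not be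
  evaluated there), `DirichletCharacter`, `DirichletCharacter.IsPrimitive/Even`, `gaussSum`,
  `ZMod.stdAddChar`, `rootsOfUnity`, `PowerSeries`, and (anchors, not used in the definitions)
  the Mahler basis `mahler k = (x ↦ x.choose k)` (`Mathlib.NumberTheory.Padics.MahlerBasis`) and
  abstract `p`-adic measures `AbstractMeasure` (`Mathlib.NumberTheory.Padics.Measure.Basic`).
  Mathlib has no `p`-adic `L`-functions of modular forms or elliptic curves (searched
  `padicL`, `MazurTate`, `modular symbol`).
* The coefficients of `L_p` are honest limits of Riemann sums of `μ_{f,α}` against the Mahler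
  functions of the *cyclotomic* variable `ℓ(x)` (`⟨x⟩ = γ^{ℓ(x)}`), parametrising `ℤ_p^×` as
  `η γ^s` with `η` a Teichmüller representative; a Riemann sum over `a mod pⁿ` of
  `μ(a + pⁿ) (a choose k)` would instead compute the Amice transform in the additive variable,
  which is not `L_p(E, T)`. The junk value of `limUnder` is used off the convergent (unit-root)
  case.
* The measure at level `0` is defined separately (`μ(ℤ_p) = (1 - α⁻¹)[0]⁺`) to avoid `ℕ`
  subtraction; `μ(ℤ_p^×) = (1 - α⁻¹)² [0]⁺` is the constant term of `L_p`.
* Only `α ∈ ℚ_p` (indeed unit roots) are treated: for supersingular `p` the roots generate a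
  quadratic extension and `μ_{f,α}` is unbounded (`h`-admissible), so Riemann sums against
  arbitrary sample points do not converge; Pollack's signed `L_p^±` (Pollack 2003, requiring the
  half-logarithms `log_p^± = p⁻¹ ∏ Φ_{2n}(1+T)/p`, resp. `Φ_{2n-1}`) and the anticyclotomic
  BDP `p`-adic `L`-function (Bertolini–Darmon–Prasanna 2013, a `p`-adic Rankin–Selberg
  construction) are therefore *not* given here, not even as `Prop` interfaces: an honest
  interface needs their defining interpolation data, which is beyond this item. They are left to
  a later item.
* Normalisations threaded from item C9 (OUTLINE §4.6): `[r]⁺ = re ((({∞,r} + {∞,-r})/2)) / Ω⁺` with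
  `Ω⁺ = 2 · gen (re Λ_f) > 0`; hence `L_p(E, 0) = (1 - α⁻¹)² L(E, 1)/Ω⁺` with this `Ω⁺`.

## References

* B. Mazur, P. Swinnerton-Dyer, *Arithmetic of Weil curves*, Invent. Math. 25 (1974), 1–61, §8–9.
* B. Mazur, J. Tate, J. Teitelbaum, *On `p`-adic analogues of the conjectures of Birch and
  Swinnerton-Dyer*, Invent. Math. 84 (1986), 1–48, Ch. I §8, §10, (10.1)–(10.4), §13, §14,
  (14.3).
* R. Greenberg, V. Vatsal, *On the Iwasawa invariants of elliptic curves*, Invent. Math. 142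
  (2000), Prop. 3.7; G. Stevens, *Stickelberger elements and modular parametrizations of
  elliptic curves*, Invent. Math. 98 (1989), 75–106, §4: Conjecture IV (4.5), Thm. (4.6),
  Cor. (4.7) (p. 93); (1.3) is Conjecture I (p. 78), not a theorem (cf. the module docstring of
  `PAdicLFunctionIntegralityProofs.lean`).
* D. Rohrlich, *On `L`-functions of elliptic curves and cyclotomic towers*, Invent. Math. 75
  (1984), 409–423, Theorem p. 409.
* R. Pollack, *On the `p`-adic `L`-function of a modular form at a supersingular prime*, Duke
  Math. J. 118 (2003); M. Bertolini, H. Darmon, K. Prasanna, *Generalized Heegner cycles and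
  `p`-adic Rankin `L`-series*, Duke Math. J. 162 (2013).
* W. Stein, C. Wuthrich, *Algorithms for the arithmetic of elliptic curves using Iwasawa theory*,
  Math. Comp. 82 (2013), §3.
* D. Delbourgo, *Elliptic curves and big Galois representations*, LMS Lecture Note Ser. 356, CUP
  2008, §2.1, Thm. 2.2 (boundedness of `μ_{f,α}` for ordinary `p`).
-/

noncomputable section

open scoped MatrixGroups ModularForm

open CongruenceSubgroup Filter Topology Literature.NumberTheory.EllipticCurves.ModularForms

namespace Literature.NumberTheory.EllipticCurves

/-! ### Ordinary primes and the unit root -/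

section Ordinary

/-- `W / ℚ` is **(good) ordinary at `p`**: `W` has good reduction at `p` and `p ∤ a_p(W)`, where
`a_p = p + 1 - #Ẽ(𝔽_p)` is the trace of Frobenius of the globally minimal model (item G06,
`WeierstrassCurve.frobeniusTrace`, `WeierstrassCurve.HasGoodReductionAtPrime`).
A DEFINITION (predicate on `(W, p)`, explicit binders), not a named fact: nothing is asserted and
there is no `_holds` to discharge; unfolding lemma `isOrdinaryAt_iff`.
Standard notion: the reduction `Ẽ / 𝔽_p` at a good prime is *ordinary* (Hasse invariant `1`) iff
it is not supersingular (Silverman, *AEC* 2nd ed., V.3, Definition after Thm. V.3.1), and `Ẽ` is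
supersingular iff `tr φ = a_p ≡ 0 (mod p)` (loc. cit., Exercise 5.10(a) with `q = p`); "`a_p` a
`p`-adic unit" is the ordinary case of the Mazur–Tate–Teitelbaum construction, where
`X² - a_p X + p` has a unique unit root (Mazur–Tate–Teitelbaum 1986, §I.11; Delbourgo 2008,
§2.1, PDF p. 41). [folklore] -/
def IsOrdinaryAt (W : WeierstrassCurve ℚ) [W.IsGloballyMinimal] (p : ℕ) [Fact p.Prime] : Prop :=
  W.HasGoodReductionAtPrime p ∧ ¬ (p : ℤ) ∣ W.frobeniusTrace p

/-- Unfolding lemma: `IsOrdinaryAt W p ↔ W` has good reduction at `p ∧ p ∤ a_p(W)`. [folklore] -/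
theorem isOrdinaryAt_iff (W : WeierstrassCurve ℚ) [W.IsGloballyMinimal] (p : ℕ) [Fact p.Prime] :
    IsOrdinaryAt W p ↔ W.HasGoodReductionAtPrime p ∧ ¬ (p : ℤ) ∣ W.frobeniusTrace p :=
  Iff.rfl

variable (W : WeierstrassCurve ℚ) [W.IsGloballyMinimal] (p : ℕ) [Fact p.Prime]

open Classical in
/-- The **unit root** `α ∈ ℤ_p^×` of the Hecke polynomial `X² - a_p X + p` of `W` at a good
ordinary prime `p`: by Hensel's lemma, if `p ∤ a_p` there is exactly one root `α ∈ ℤ_p` which is a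
unit (`α ≡ a_p mod p`; the other root is `β = p/α ∈ pℤ_p`). Junk value `0` when there is no unique
unit root (e.g. `p` supersingular) (Mazur–Tate–Teitelbaum 1986, §I.11, "allowable root";
Mazur–Swinnerton-Dyer 1974, §9). [cite: MazurTateTeitelbaum1986Invent, §I.11 (allowable root)] -/
def unitRoot : ℤ_[p] :=
  if h : ∃! α : ℤ_[p], α ^ 2 - (W.frobeniusTrace p : ℤ_[p]) * α + p = 0 ∧ IsUnit α
  then h.choose else 0

/-- Defining property of `unitRoot`: at a good ordinary prime, `α = unitRoot W p` is a unit of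
`ℤ_p` with `α² - a_p α + p = 0` (Hensel's lemma, Mathlib `hensels_lemma`, applied to
`X² - a_p X + p` at the approximate root `a_p`, since `p ∤ a_p = F'(a_p) + O(p)`)
(Mazur–Tate–Teitelbaum 1986, §I.11). [cite: MazurTateTeitelbaum1986Invent, §I.11] -/
def unitRoot_spec : Prop :=
  ∀ (h : IsOrdinaryAt W p),
    unitRoot W p ^ 2 - (W.frobeniusTrace p : ℤ_[p]) * unitRoot W p + p = 0 ∧
      IsUnit (unitRoot W p)

/-- At a good ordinary prime the unit root has `p`-adic absolute value `1` in `ℚ_p`: immediate from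
`unitRoot_spec` (a unit of `ℤ_p` has norm `1`); proved from it as
`norm_unitRoot_of_unitRoot_spec` below. [folklore] -/
def norm_unitRoot : Prop :=
  ∀ (h : IsOrdinaryAt W p),
    ‖(unitRoot W p : ℚ_[p])‖ = 1

/- interim proof relied on results that are now named facts (D-0014); demoted to a fact by the D-0014 sorry-sweep, proof preserved:
:= by
  rw [PadicInt.padic_norm_e_of_padicInt]
  exact PadicInt.isUnit_iff.mp (unitRoot_spec W p h).2
-/

/-- `norm_unitRoot` follows from `unitRoot_spec`: a unit of `ℤ_p` has norm `1`. [folklore] -/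
theorem norm_unitRoot_of_unitRoot_spec (hspec : unitRoot_spec W p) : norm_unitRoot W p :=
  fun h ↦ by
    rw [PadicInt.padic_norm_e_of_padicInt]
    exact PadicInt.isUnit_iff.mp (hspec h).2

end Ordinary

/-! ### Rational modular symbols and the Mazur–Swinnerton-Dyer measure -/

section Measure

variable {N : ℕ} (f : CuspForm (Gamma0 N) 2) {p : ℕ} [Fact p.Prime]

open Classical in
/-- The **rational plus symbol** `[r]⁺_f ∈ ℚ`: the rational number `q` with
`(q : ℝ) = normalizedPlusSymbol f r = re (plusSymbol f r) / Ω⁺_f` (conventions of item C9: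
`plusSymbol f r = ({∞, r} + {∞, -r})/2`, `re Λ_f = ℤ · Ω⁺_f/2`, `[0]⁺ = L(f, 1)/Ω⁺_f`), if it
exists, and the junk value `0` otherwise. For a normalised newform with rational coefficients such
a `q` exists for every `r` by the Manin–Drinfeld theorem
(`IsNewform0.exists_normalizedPlusSymbol_eq_ratCast`). We pass through `ℚ` because a real number
cannot be transported to `ℚ_p` (Mazur–Tate–Teitelbaum 1986, §I.8, §I.10).
[cite: MazurTateTeitelbaum1986Invent, §I.8 and §I.10] -/
def ratPlusSymbol (r : ℚ) : ℚ :=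
  if h : ∃ q : ℚ, (q : ℝ) = normalizedPlusSymbol f r then h.choose else 0

/-- Defining property of `ratPlusSymbol` for rational newforms: `(ratPlusSymbol f r : ℝ) = [r]⁺_f`
(Manin–Drinfeld; Mazur–Tate–Teitelbaum 1986, §I.8). [cite: MazurTateTeitelbaum1986Invent, §I.8] -/
def ratCast_ratPlusSymbol : Prop :=
  ∀ [NeZero N] {f : CuspForm (Gamma0 N) 2} (hf : IsNewform0 f) (hQ : coeffField f = ⊥) (r : ℚ),
    (ratPlusSymbol f r : ℝ) = normalizedPlusSymbol f r

/- interim proof relied on results that are now named facts (D-0014); demoted to a fact by the D-0014 sorry-sweep, proof preserved: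
:= by
  obtain ⟨q, hq⟩ := hf.exists_normalizedPlusSymbol_eq_ratCast hQ r
  have h : ∃ q : ℚ, (q : ℝ) = normalizedPlusSymbol f r := ⟨q, hq.symm⟩
  rw [ratPlusSymbol, dif_pos h]
  exact h.choose_spec
-/

/-- `[r + 1]⁺ = [r]⁺`: the rational plus symbol only depends on `r mod ℤ`
(`modularSymbol_add_intCast`) (Mazur–Tate–Teitelbaum 1986, §I.4 (4.2)).
[cite: MazurTateTeitelbaum1986Invent, §I.4 (4.2)] -/
def ratPlusSymbol_add_intCast : Prop :=
  ∀ [NeZero N] (r : ℚ) (n : ℤ),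
    ratPlusSymbol f (r + n) = ratPlusSymbol f r

/- interim proof relied on results that are now named facts (D-0014); demoted to a fact by the D-0014 sorry-sweep, proof preserved:
:= by
  have h1 : modularSymbol f (r + n) = modularSymbol f r := by
    exact_mod_cast modularSymbol_add_intCast f r n
  have h2 : modularSymbol f (-(r + n)) = modularSymbol f (-r) := by
    have := modularSymbol_add_intCast f (-r) (-n)
    push_cast at this
    rw [← this]
    ring_nf
  have h3 : normalizedPlusSymbol f (r + n) = normalizedPlusSymbol f r := by
    simp only [normalizedPlusSymbol, plusSymbol, h1, h2]
  unfold ratPlusSymbol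
  rw [h3]
-/

/-- The **Mazur–Swinnerton-Dyer / Mazur–Tate–Teitelbaum measure** `μ_{f,α}⁺` attached to `f` and
`α ∈ ℚ_p^×`, on the compact opens `a + pⁿℤ_p` of `ℤ_p` (`a : ZMod (p ^ n)`):
`μ(a + pⁿℤ_p) = α⁻ⁿ [a/pⁿ]⁺ - α⁻⁽ⁿ⁺¹⁾ [a/pⁿ⁻¹]⁺` for `n ≥ 1`
(Mazur–Tate–Teitelbaum 1986, §I.10, (10.1) with trivial Nebentypus `ε(p) = 1`;
Stein–Wuthrich 2013, (3.2)), where `[·]⁺ = ratPlusSymbol f`, cast `ℚ → ℚ_p`, and `a` is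
represented by `a.val ∈ [0, pⁿ)` (any representative gives the same value,
`ratPlusSymbol_add_intCast`). For `n = 0` (`ZMod 1`, the whole of `ℤ_p`) we set
`μ(ℤ_p) = (1 - α⁻¹) [0]⁺`, which is `∑_{a mod p} μ(a + pℤ_p)` when `α` is a root of the Hecke
polynomial (`msdMeasure_distribution`), so that `μ(ℤ_p^×) = μ(ℤ_p) - μ(pℤ_p) = (1 - α⁻¹)² [0]⁺`.
Junk (but harmless) for `α = 0` (`0⁻¹ = 0`). [cite: MazurTateTeitelbaum1986Invent, §I.10 (10.1)] -/
def msdMeasure (α : ℚ_[p]) : (n : ℕ) → ZMod (p ^ n) → ℚ_[p]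
  | 0, _ => (1 - α⁻¹) * (ratPlusSymbol f 0 : ℚ_[p])
  | n + 1, a =>
    α⁻¹ ^ (n + 1) * (ratPlusSymbol f ((a.val : ℚ) / (p : ℚ) ^ (n + 1)) : ℚ_[p]) -
      α⁻¹ ^ (n + 2) * (ratPlusSymbol f ((a.val : ℚ) / (p : ℚ) ^ n) : ℚ_[p])

/-- **Distribution property** of `μ_{f,α}` (Mazur–Tate–Teitelbaum 1986, §I.10, Prop. (10.2);
Mazur–Swinnerton-Dyer 1974, §8): if `f` is a normalised newform of level `N` prime to `p` with
rational coefficients, `a_p(f) = a_p ∈ ℤ`, and `α ≠ 0` satisfies `α² - a_p α + p = 0`, then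
`∑_{b ≡ a mod pⁿ} μ(b + pⁿ⁺¹ℤ_p) = μ(a + pⁿℤ_p)`. This follows from the Hecke relation
`a_p [r]⁺ = ∑_{u mod p} [(r + u)/p]⁺ + [p r]⁺` (MTT (4.2)).
[cite: MazurTateTeitelbaum1986Invent, §I.10 Prop. (10.2)] -/
def msdMeasure_distribution : Prop :=
  ∀ [NeZero N] {f : CuspForm (Gamma0 N) 2} (hf : IsNewform0 f) (hQ : coeffField f = ⊥) (hpN : ¬ p ∣ N) {ap : ℤ} (hap : cuspCoeff f p = ap) {α : ℚ_[p]} (hα₀ : α ≠ 0) (hα : α ^ 2 - ap * α + p = 0) (n : ℕ) (a : ZMod (p ^ n)),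
    ∑ b ∈ Finset.univ.filter
        (fun b : ZMod (p ^ (n + 1)) ↦ ZMod.castHom (pow_dvd_pow p n.le_succ) (ZMod (p ^ n)) b = a),
      msdMeasure f α (n + 1) b = msdMeasure f α n a

end Measure

/-! ### The cyclotomic variable and the `p`-adic `L`-function -/

section Cyclotomic

variable (p : ℕ) [Fact p.Prime]

/-- The exponent `e₀` with `Γ = 1 + p^{e₀} ℤ_p` the torsion-free part of `ℤ_p^×`: `e₀ = 1` for odd
`p` (`ℤ_p^× = μ_{p-1} × (1 + pℤ_p)`) and `e₀ = 2` for `p = 2` (`ℤ_2^× = {±1} × (1 + 4ℤ_2)`)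
(Mazur–Tate–Teitelbaum 1986, §I.13; Washington, *Cyclotomic fields*, §7.2).
[cite: MazurTateTeitelbaum1986Invent, §I.13] -/
def cyclotomicExponent : ℕ := if p = 2 then 2 else 1

/-- The **topological generator** `γ = 1 + p^{e₀}` of `Γ = 1 + p^{e₀}ℤ_p` (`γ = 1 + p` for odd
`p`, `γ = 5` for `p = 2`); the variable `T` of the `p`-adic `L`-function corresponds to `γ - 1`,
i.e. `1 + T ↔ γ` under `Λ = ℤ_p⟦T⟧ ≅ ℤ_p⟦Γ⟧` (item C11 `IwasawaAlgebra`; Mazur–Tate–Teitelbaum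
1986, §I.13). [folklore] -/
def cyclotomicGenerator : ℕ := 1 + p ^ cyclotomicExponent p

/-- The order `φ(p^{e₀})` of the torsion subgroup of `ℤ_p^×` (`p - 1` for odd `p`, `2` for
`p = 2`): the torsion of `ℤ_p^×` is `rootsOfUnity (torsionOrder p) ℤ_[p]`, the group of
Teichmüller representatives (Washington §5.1; Mathlib `rootsOfUnity`). [folklore] -/
def torsionOrder : ℕ := Nat.totient (p ^ cyclotomicExponent p)

end Cyclotomic

section LFunction

variable {N : ℕ} (f : CuspForm (Gamma0 N) 2) {p : ℕ} [Fact p.Prime]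

/-- The `n`-th **Riemann sum** for the `k`-th coefficient of `L_p(f, α, T)`:
`∑_{η} ∑_{s mod pⁿ} μ_{f,α}(η γˢ + p^{n+e₀}ℤ_p) · (s choose k)`,
where `η` runs over the Teichmüller representatives (torsion of `ℤ_p^×`), `γ = 1 + p^{e₀}` and
`s` is represented by `s.val ∈ [0, pⁿ)`. Every `x ∈ ℤ_p^×` is uniquely `x = η γ^{ℓ(x)}` with
`ℓ(x) ∈ ℤ_p`, and `{η γ^t : t ≡ s mod pⁿ} = η γˢ (1 + p^{n+e₀}ℤ_p) = η γˢ + p^{n+e₀}ℤ_p`; so this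
is a Riemann sum for `∫_{ℤ_p^×} (ℓ(x) choose k) dμ_{f,α}(x)`, the `k`-th coefficient of
`∫_{ℤ_p^×} (1 + T)^{ℓ(x)} dμ_{f,α}(x)` (Mazur–Tate–Teitelbaum 1986, §I.13; Stein–Wuthrich 2013,
§3.3–3.4; Mathlib `mahler k` is `x ↦ x.choose k` on `ℤ_[p]`). The sum over
`rootsOfUnity (torsionOrder p) ℤ_[p]` is a `finsum` over a finite type.
[cite: MazurTateTeitelbaum1986Invent, §I.13] -/
def padicLRiemannSum (α : ℚ_[p]) (k n : ℕ) : ℚ_[p] :=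
  ∑ᶠ η : rootsOfUnity (torsionOrder p) ℤ_[p], ∑ s : ZMod (p ^ n),
    msdMeasure f α (n + cyclotomicExponent p)
        (PadicInt.toZModPow (n + cyclotomicExponent p) ((η : ℤ_[p]ˣ) : ℤ_[p]) *
          (cyclotomicGenerator p : ZMod (p ^ (n + cyclotomicExponent p))) ^ s.val) *
      (s.val.choose k : ℚ_[p])

/-- The `k`-th **coefficient of the `p`-adic `L`-function** `L_p(f, α, T) = ∑ c_k T^k`:
`c_k = ∫_{ℤ_p^×} (ℓ(x) choose k) dμ_{f,α}(x) = lim_n padicLRiemannSum f α k n`. The limit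
exists when `μ_{f,α}` is a measure (bounded), i.e. for `α` a `p`-adic unit root
(`tendsto_padicLRiemannSum`); otherwise this is the junk value of `limUnder`
(Mazur–Tate–Teitelbaum 1986, §I.11–I.13). [cite: MazurTateTeitelbaum1986Invent, §I.11–I.13] -/
def padicLCoeff (α : ℚ_[p]) (k : ℕ) : ℚ_[p] :=
  limUnder atTop (padicLRiemannSum f α k)

/-- The **`p`-adic `L`-function** `L_p(f, α, T) ∈ ℚ_p⟦T⟧` of a weight-`2` cusp form `f` on
`Γ₀(N)` and a unit root `α` of `X² - a_p X + p`:
`L_p(f, α, T) = ∫_{ℤ_p^×} (1 + T)^{ℓ(x)} dμ_{f,α}(x)`, where `⟨x⟩ = γ^{ℓ(x)}`, `γ = 1 + p^{e₀}`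
(`cyclotomicGenerator`), so that `T ↔ γ - 1` is the cyclotomic variable of `Λ = ℤ_p⟦T⟧ ≅ ℤ_p⟦Γ⟧`
(item C11). For a continuous character `χ` of `Γ`, `L_p(f, α, χ(γ) - 1) = ∫_{ℤ_p^×} χ dμ_{f,α}`
(Mazur–Swinnerton-Dyer 1974, §9; Mazur–Tate–Teitelbaum 1986, §I.13; Stein–Wuthrich 2013, §3).
[cite: MazurSwinnertonDyer1974Invent, §9] -/
def padicLFunction (α : ℚ_[p]) : PowerSeries ℚ_[p] :=
  PowerSeries.mk (padicLCoeff f α)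

/-- The `k`-th coefficient of `L_p(f, α, T)` is `padicLCoeff f α k`. [folklore] -/
@[simp] theorem coeff_padicLFunction (α : ℚ_[p]) (k : ℕ) :
    PowerSeries.coeff k (padicLFunction f α) = padicLCoeff f α k :=
  PowerSeries.coeff_mk _ _

/-- The constant term of `L_p(f, α, T)` is `padicLCoeff f α 0 = ∫_{ℤ_p^×} dμ_{f,α}`. [folklore] -/
@[simp] theorem constantCoeff_padicLFunction (α : ℚ_[p]) :
    PowerSeries.constantCoeff (padicLFunction f α) = padicLCoeff f α 0 :=
  PowerSeries.constantCoeff_mk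

/-- The **rational twisted symbol sum** `∑_{a mod m} χ(a) [a/m]⁺_f ∈ R` for a Dirichlet character
`χ` mod `m` with values in a field `R` of characteristic zero (`[·]⁺ = ratPlusSymbol`, cast
`ℚ → R`). For `R = ℂ`, `χ` even primitive and `f` a rational newform this is
`τ(χ) L(f, χ̄, 1) / Ω⁺_f` (`ratTwistedSymbolSum_mul_plusPeriod`, Birch's formula); for
`R = ℂ_p` it is the right-hand side of the `p`-adic interpolation formula
(Mazur–Tate–Teitelbaum 1986, §I.8, (8.6), §I.14).
[cite: MazurTateTeitelbaum1986Invent, §I.8 (8.6)] -/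
def ratTwistedSymbolSum {R : Type*} [Field R] {m : ℕ} [NeZero m] (χ : DirichletCharacter R m) :
    R :=
  ∑ a : ZMod m, χ a * (ratPlusSymbol f ((a.val : ℚ) / m) : R)

variable (p) in
/-- `IsPAdicLFunctionOf f p α L`: the power series `L ∈ ℚ_p⟦T⟧` has the **interpolation property**
of the `p`-adic `L`-function of `(f, α)` (Mazur–Tate–Teitelbaum 1986, §I.14, (14.3) with trivial
tame character; Stein–Wuthrich 2013, (3.5)):
* `L(0) = ∫_{ℤ_p^×} dμ_{f,α} = (1 - α⁻¹)² [0]⁺_f` (`= (1 - α⁻¹)² L(f, 1)/Ω⁺_f`), and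
* for every `m ≥ 1` and every primitive Dirichlet character `χ` of conductor `p^m` with values in
  `ℂ_p` which is a character of `Γ` (i.e. even and of `p`-power order, equivalently trivial on the
  torsion of `ℤ_p^×`), the series `L(χ(γ) - 1) = ∑_k c_k (χ(γ) - 1)^k` converges in `ℂ_p` to
  `α⁻ᵐ ∑_{a mod p^m} χ(a) [a/p^m]⁺_f` (`= α⁻ᵐ τ(χ) L(f, χ̄, 1)/Ω⁺_f` by Birch's formula,
  `ratTwistedSymbolSum_mul_plusPeriod`), where `γ = cyclotomicGenerator p`.
The case `m = 0` (trivial `χ`) is excluded from the second clause: there the Euler-factor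
`(1 - α⁻¹)²` of the first clause appears instead.
[cite: MazurTateTeitelbaum1986Invent, §I.14 (14.3)] -/
def IsPAdicLFunctionOf (α : ℚ_[p]) (L : PowerSeries ℚ_[p]) : Prop :=
  PowerSeries.constantCoeff L = (1 - α⁻¹) ^ 2 * (ratPlusSymbol f 0 : ℚ_[p]) ∧
    ∀ (m : ℕ), 0 < m → ∀ χ : DirichletCharacter ℂ_[p] (p ^ m), χ.IsPrimitive → χ.Even →
      (∃ j : ℕ, orderOf χ = p ^ j) →
        HasSum (fun k : ℕ ↦ algebraMap ℚ_[p] ℂ_[p] (PowerSeries.coeff k L) *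
            (χ (cyclotomicGenerator p : ZMod (p ^ m)) - 1) ^ k)
          (algebraMap ℚ_[p] ℂ_[p] (α⁻¹ ^ m) * ratTwistedSymbolSum f χ)

end LFunction

/-! ### Theorems -/

section Theorems

variable {N : ℕ} [NeZero N] {f : CuspForm (Gamma0 N) 2} {p : ℕ} [Fact p.Prime]

/-- **Birch's formula for `[·]⁺`**: for a rational newform `f`, an even primitive Dirichlet
character `χ` mod `m` and the entire continuation `L` of `L(f, χ̄, s)`,
`(∑_{a mod m} χ(a) [a/m]⁺_f) · Ω⁺_f = τ(χ) · L(f, χ̄, 1)`. Indeed for even `χ`,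
`∑ χ(a) plusSymbol f (a/m) = ∑ χ(a) {∞, a/m} = twistedSymbolSum f χ` and `plusSymbol f r` is real
for real-coefficient `f`; conclude by `twisted_LValue_eq` (Mazur–Tate–Teitelbaum 1986, §I.8,
(8.6); Cremona §2.8). [cite: MazurTateTeitelbaum1986Invent, §I.8 (8.6)] -/
def ratTwistedSymbolSum_mul_plusPeriod : Prop :=
  ∀ (hf : IsNewform0 f) (hQ : coeffField f = ⊥) {m : ℕ} [NeZero m] {χ : DirichletCharacter ℂ m} (hχ : χ.IsPrimitive) (hχe : χ.Even) {L : ℂ → ℂ} (hL : Differentiable ℂ L) (hL' : ∀ s : ℂ, 2 < s.re → L s = twistedLSeries f χ⁻¹ s),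
    ratTwistedSymbolSum f χ * (plusPeriod f : ℂ) = gaussSum χ (ZMod.stdAddChar (N := m)) * L 1

/-- **`μ_{f,α}` is a measure for a unit root**: if `f` is a rational newform of level prime to
`p`, `α ∈ ℤ_p^×` is a root of `X² - a_p X + p`, then the Riemann sums defining the `k`-th
coefficient of `L_p(f, α, T)` converge (the values of `μ_{f,α}` are bounded since the `[r]⁺_f`
have bounded denominators and `|α⁻¹|_p = 1`, and `x ↦ (ℓ(x) choose k)` is continuous)
(Mazur–Tate–Teitelbaum 1986, §I.11–I.13; Mazur–Swinnerton-Dyer 1974, §8).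
[cite: MazurTateTeitelbaum1986Invent, §I.11–I.13] -/
def tendsto_padicLRiemannSum : Prop :=
  ∀ (hf : IsNewform0 f) (hQ : coeffField f = ⊥) (hpN : ¬ p ∣ N) {ap : ℤ} (hap : cuspCoeff f p = ap) {α : ℚ_[p]} (hα : α ^ 2 - ap * α + p = 0) (hαu : ‖α‖ = 1) (k : ℕ),
    Tendsto (padicLRiemannSum f α k) atTop (𝓝 (padicLCoeff f α k))

/-- **`μ_{f,α}` is a bounded measure for the unit root** (Delbourgo 2008, Thm. 2.2, quoting
[MTT, §I]: "if `a_p(f)` is a `p`-adic unit then `μ_{f,α_p}` is a bounded measure";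
Mazur–Tate–Teitelbaum 1986, §I.11): if `f` is a rational normalised newform of level `N` prime
to `p`, `a_p(f) = a_p ∈ ℤ`, and `α ∈ ℚ_p` with `α² - a_p α + p = 0`, `|α|_p = 1` (the unit
root), then the values `μ_{f,α}(a + pⁿℤ_p)` (`msdMeasure f α n a`) are bounded in `ℚ_p` uniformly
in `n` and `a` (the `[r]⁺_f` have bounded denominators — Manin — and `|α⁻¹|_p = 1`). Same
hypotheses as `tendsto_padicLRiemannSum`; this is the domination needed to integrate continuous
functions against `μ_{f,α}` (used by `isPAdicLFunctionOf_padicLFunction_of` in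
`PAdicLFunctionInterpolationProofs`). [cite: Delbourgo2008, Thm. 2.2 (PDF p. 41)] -/
def exists_norm_msdMeasure_le : Prop :=
  ∀ (_ : IsNewform0 f) (_ : coeffField f = ⊥) (_ : ¬ p ∣ N) {ap : ℤ} (_ : cuspCoeff f p = ap)
    {α : ℚ_[p]} (_ : α ^ 2 - ap * α + p = 0) (_ : ‖α‖ = 1),
    ∃ C : ℝ, ∀ (n : ℕ) (a : ZMod (p ^ n)), ‖msdMeasure f α n a‖ ≤ C

/-- The **`p`-adic `L`-function `L_p(E, T)` of an elliptic curve** `E = W / ℚ` at a good ordinary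
prime `p`: `L_p(f, α, T)` for `f` the newform of `W` (modularity, item C7 `IsNewformOf`; `f` is
unique, `existsUnique_isNewformOf`, and is determined by the anonymous proof argument
`IsNewformOf W f`, which is not used in the data) and `α = unitRoot W p`
(Mazur–Tate–Teitelbaum 1986, §I.11, §I.13).
[cite: MazurTateTeitelbaum1986Invent, §I.11 and §I.13] -/
def padicLFunctionE (W : WeierstrassCurve ℚ) [W.IsGloballyMinimal] (p : ℕ) [Fact p.Prime]
    (_ : IsNewformOf W f) : PowerSeries ℚ_[p] :=
  padicLFunction f (unitRoot W p : ℚ_[p])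

variable {W : WeierstrassCurve ℚ} [W.IsElliptic] [W.IsGloballyMinimal]

/-- If `f` is the newform of `W` and `W` has good reduction at `p`, then `a_p(f) = a_p(W)` is the
trace of Frobenius of the minimal model (item C7 `IsNewformOf`: `a_p(f)` is the `p`-th coefficient
of Mathlib's `WeierstrassCurve.LFunction`, the Euler product `∏_v f_v(‖v‖⁻ˢ)⁻¹` with
`f_p(T) = 1 - a_p T + p T²`, `a_p = p + 1 - #Ẽ(𝔽_p)` at a good prime, so its `p`-th Dirichlet
coefficient is `a_p`; given `hf.2 p` this is that expansion for the tree's `frobeniusTrace`, item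
G06) (Silverman, *AEC* C.16, definition of `L_E(s)` and of `a_p`; modularity itself,
Diamond–Shurman Thm. 8.8.1, is inside the hypothesis `IsNewformOf`).
[cite: SilvermanAEC2009, §C.16 (definition of L_E(s))] -/
def cuspCoeff_eq_frobeniusTrace_of_isNewformOf : Prop :=
  ∀ (hf : IsNewformOf W f) (hp : W.HasGoodReductionAtPrime p),
    cuspCoeff f p = (W.frobeniusTrace p : ℂ)

/-- **Mazur–Swinnerton-Dyer / Mazur–Tate–Teitelbaum**: at a good ordinary prime `p`,
`L_p(E, T) = L_p(f, α, T)` (with `f` the newform of `E = W` and `α = unitRoot W p`) has the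
interpolation property `IsPAdicLFunctionOf` (Mazur–Swinnerton-Dyer 1974, §9;
Mazur–Tate–Teitelbaum 1986, §I.14, (14.3)). [cite: MazurSwinnertonDyer1974Invent, §9] -/
def isPAdicLFunctionOf_padicLFunction : Prop :=
  ∀ (hord : IsOrdinaryAt W p) (hf : IsNewformOf W f),
    IsPAdicLFunctionOf f p (unitRoot W p : ℚ_[p]) (padicLFunction f (unitRoot W p : ℚ_[p]))

/-- **Integrality** (`L_p(E, T) ∈ Λ = ℤ_p⟦T⟧`): for `p` odd and good ordinary, if the mod-`p`
Galois representation `E[p]` is irreducible then all coefficients of `L_p(E, T)` lie in `ℤ_p`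
(the measure `μ_{f,α}` is `ℤ_p`-valued: Greenberg–Vatsal 2000, Prop. 3.7; Stevens 1989, §4,
Thm. 4.6 / Cor. 4.7 (p. 93) — `c(π)·ν_A` integral for any `X₁(N)`-parametrisation `π`, i.e.
integrality up to the Manin constant; Stevens' (1.3) is his Conjecture I, not a theorem).
Irreducibility of `E[p]` is an isogeny invariant, and `Ω⁺_f` (item C9) is the real
Néron period of the optimal curve up to the Manin constant, a `p`-adic unit for good odd `p`
(Mazur 1978; Abbes–Ullmo 1996), so the statement does not depend on the curve `W` in the isogeny
class of `f`. Without irreducibility `L_p(E, T)` may have `μ`-invariant `> 0` or denominators.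
Greenberg–Vatsal 2000, Prop. (3.7): "Assume either that `E` is optimal, or that `E[p]` is
irreducible … Then `L(E/ℚ, χ, T) ∈ Λ`" (`p` odd good ordinary; here `χ = 1`).
[cite: GreenbergVatsal2000, Prop. 3.7] -/
def padicLFunction_mem_integral : Prop :=
  ∀ (hp : p ≠ 2) (hord : IsOrdinaryAt W p) (hf : IsNewformOf W f) (hirr : W.HasIrreducibleModPGaloisRep p) (k : ℕ),
    ‖padicLCoeff f (unitRoot W p : ℚ_[p]) k‖ ≤ 1

/-- **Non-vanishing of `L_p(E, T)`** (Rohrlich 1984, Theorem, p. 409): `L(E, χ, 1) ≠ 0` for all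
but finitely many Dirichlet characters `χ` of `p`-power conductor, hence by the interpolation
property `L_p(E, T) ≠ 0` at a good ordinary prime `p` (Mazur–Tate–Teitelbaum 1986, §I.14).
[cite: RohrlichInventiones1984, Theorem (p. 409)] -/
def padicLFunction_ne_zero : Prop :=
  ∀ (hord : IsOrdinaryAt W p) (hf : IsNewformOf W f),
    padicLFunction f (unitRoot W p : ℚ_[p]) ≠ 0

end Theorems

end Literature.NumberTheory.EllipticCurves
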